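import Summits.QuantumFields.YangMills.Theorems.BalabanUVNodesN08LaunderingLocal

/-!
# BalabanUVNodes ∕ N08 — MARKOV READ-SET TONELLI: from an ARBITRARY finite source law whose `R`-coordinates are right-translation invariant, a weight reading only `R` integrates out to
# its Haar mean against any weight and any map blind to `R` — the mass-extraction half of the deletion step in the Markov organisation (memo M6′ §2(c)∕§3, unit (T1′)); the extracted
# constant is the SAME whichever map is used above, which is what makes fired and ghost terms cancel

Track A, DAG node N08 ([Balaban1985UV3] Thm 1 p. 257 ∕ Thm 2 p. 272; averaging [Balaban1987RG1] (0.4) p. 253).  Cell `pub-ymgap`, seat `pub-ymgap-dag-n08-d` g47 (R529-ym job; memo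
`N08-HJ-M6-CANCELLATION-g47.md`); ledger key `--supports stmt-QuantumFields-27364 --as helper` («cc 19936 (O‴χₛ) supply», director №326).  Over ✓p759076 `…N08LaunderingLocal`
§2 (`eq_fst_prod_pi_of_mixed_translations` with `T = univ`).  The product-Haar case is px8 ✓p758675 `UV3ReadSetFactorisation`.

CONTENTS ([folklore]; 0 `def`, 0 `sorry`): `measurable_fillR` ∕ `measurable_fillRc` (filling coordinates with `1`), `map_split_eq_fst_prod_of_invariant` (an `R`-right-invariant finite law
splits as `(marginal off R) ⊗ Haar^R`), ★★★ `map_withDensity_mul_eq_smul_of_invariant` — `(μ.withDensity (f_c·f′)).map φ = c₀ • (μ.withDensity f′).map φ`,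
`c₀ = ∫ f_c ∘ fill dHaar^R`.
HONEST: count-neutral helper; hTop ∕ hJ NOT proved; N08 NOT discharged; R3 ≠ d = 4 ∕ mass gap ∕ Clay.
-/

noncomputable section

open MeasureTheory
open scoped ENNReal

namespace Summit.QuantumFields.YangMills.Theorems.BalabanUVNodesN08MarkovReadSetTonelli

open Literature.MathematicalPhysics.QuantumFieldTheory.Balaban1983to89
open Literature.MathematicalPhysics.QuantumFieldTheory.Balaban1983to89.T4Continuum
open Summit.QuantumFields.YangMills.Theorems.BalabanUVNodesN08LaunderingLocal (eq_fst_prod_pi_of_mixed_translations)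

variable {P : Params} {j : ℕ} {G : Type*} [GaugeGroup G] [MeasurableSpace G]

/-- Filling a level-`j` field from its `R`-coordinates (`1` elsewhere) is measurable. [folklore] -/
theorem measurable_fillR (R : Set (PBond P j)) [DecidablePred (· ∈ R)] :
    Measurable (fun (u : ↥R → G) (b : PBond P j) => if hb : b ∈ R then u ⟨b, hb⟩ else (1 : G)) := by
  refine measurable_pi_iff.mpr fun b => ?_
  by_cases hb : b ∈ R
  · simp only [hb, dif_pos]; exact measurable_pi_apply _
  · simp only [hb, dif_neg, not_false_eq_true]; exact measurable_const

/-- Filling a level-`j` field from its `Rᶜ`-coordinates (`1` on `R`) is measurable. [folklore] -/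
theorem measurable_fillRc (R : Set (PBond P j)) [DecidablePred (· ∈ R)] :
    Measurable (fun (v : ↥Rᶜ → G) (b : PBond P j) => if hb : b ∈ R then (1 : G) else v ⟨b, hb⟩) := by
  refine measurable_pi_iff.mpr fun b => ?_
  by_cases hb : b ∈ R
  · simp only [hb, dif_pos]; exact measurable_const
  · simp only [hb, dif_neg, not_false_eq_true]; exact measurable_pi_apply _

variable [HaarData G] [MeasurableMul₂ G] [MeasurableInv G]

/-- **An `R`-right-invariant finite law splits as `(marginal off R) ⊗ Haar^R`** in the split coordinates `U ↦ (U|Rᶜ, U|R)` (✓`eq_fst_prod_pi_of_mixed_translations` with `T = univ`).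
[folklore] -/
theorem map_split_eq_fst_prod_of_invariant (μ : Measure (GaugeField P j G)) [IsFiniteMeasure μ] (R : Set (PBond P j)) [DecidablePred (· ∈ R)]
    (hμR : ∀ h : GaugeField P j G, (∀ b, b ∉ R → h b = 1) → MeasurePreserving (fun (U : GaugeField P j G) b => U b * h b) μ μ) :
    μ.map (fun U : GaugeField P j G => ((fun b : ↥Rᶜ => U b), (fun b : ↥R => U b))) =
      (μ.map (fun U : GaugeField P j G => fun b : ↥Rᶜ => U b)).prod (Measure.pi fun _ : ↥R => (HaarData.haar : Measure G)) := by
  classical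
  have hpA : Measurable (fun (U : GaugeField P j G) (b : ↥R) => U b) := measurable_pi_iff.mpr fun b => measurable_pi_apply (b : PBond P j)
  have hpB : Measurable (fun (U : GaugeField P j G) (b : ↥Rᶜ) => U b) := measurable_pi_iff.mpr fun b => measurable_pi_apply (b : PBond P j)
  have hsplit : Measurable (fun U : GaugeField P j G => ((fun b : ↥Rᶜ => U b), (fun b : ↥R => U b))) := hpB.prodMk hpA
  set κ := μ.map (fun U : GaugeField P j G => ((fun b : ↥Rᶜ => U b), (fun b : ↥R => U b))) with hκ
  haveI : IsFiniteMeasure κ := Measure.isFiniteMeasure_map _ _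
  have hfst : κ.map Prod.fst = μ.map (fun U : GaugeField P j G => fun b : ↥Rᶜ => U b) := by
    rw [hκ, Measure.map_map measurable_fst hsplit]; rfl
  rw [← hfst]
  refine eq_fst_prod_pi_of_mixed_translations (G := G) (Set.univ : Set ↥R) κ ?_ ?_
  · intro h _
    set hx : GaugeField P j G := fun b => if hb : b ∈ R then h ⟨b, hb⟩ else 1 with hhx
    have hx1 : ∀ b, b ∉ R → hx b = 1 := fun b hb => by simp [hhx, hb]
    have hTm : Measurable (fun p : (↥Rᶜ → G) × (↥R → G) => (p.1, fun i => p.2 i * h i)) :=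
      measurable_fst.prodMk (measurable_pi_iff.mpr fun i => ((measurable_pi_apply i).comp measurable_snd).mul_const _)
    have hcomp : ((fun p : (↥Rᶜ → G) × (↥R → G) => (p.1, fun i => p.2 i * h i)) ∘ fun U : GaugeField P j G => ((fun b : ↥Rᶜ => U b), (fun b : ↥R => U b))) =
        (fun U : GaugeField P j G => ((fun b : ↥Rᶜ => U b), (fun b : ↥R => U b))) ∘ fun U b => U b * hx b := by
      funext U
      refine Prod.ext ?_ ?_
      · funext b; show U b = U b * hx b; rw [hx1 _ b.2, mul_one]
      · funext b; show U b * h b = U b * hx b; rw [hhx]; simp only [b.2, dif_pos]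
    calc κ.map (fun p : (↥Rᶜ → G) × (↥R → G) => (p.1, fun i => p.2 i * h i))
        = μ.map ((fun U : GaugeField P j G => ((fun b : ↥Rᶜ => U b), (fun b : ↥R => U b))) ∘ fun U b => U b * hx b) := by
          rw [hκ, Measure.map_map hTm hsplit, hcomp]
      _ = (μ.map (fun (U : GaugeField P j G) b => U b * hx b)).map (fun U : GaugeField P j G => ((fun b : ↥Rᶜ => U b), (fun b : ↥R => U b))) :=
          (Measure.map_map hsplit (hμR hx hx1).measurable).symm
      _ = κ := by rw [hκ]; exact congrArg (Measure.map _) (hμR hx hx1).map_eq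
  · intro h hh
    have h1 : h = 1 := funext fun i => hh i (Set.mem_univ i)
    subst h1
    have : (fun p : (↥Rᶜ → G) × (↥R → G) => (p.1, fun i => (1 : ↥R → G) i * p.2 i)) = id := by
      funext p; refine Prod.ext rfl ?_; funext i; exact one_mul _
    rw [this, Measure.map_id]

/-- ★★★ **MARKOV READ-SET TONELLI.**  `μ` a finite law on level-`j` fields, invariant under right multiplication of the `R`-coordinates; `f_c ≥ 0` measurable READING ONLY `R`;
`f′ ≥ 0` measurable and `φ` measurable BLIND to `R`.  Then `(μ.withDensity (f_c·f′)).map φ = c₀ • (μ.withDensity f′).map φ` with `c₀ = ∫ f_c(fill u) dHaar^R(u)` — the weight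
reading `R` integrates out to its Haar mean, a constant that does not see `f′`, `φ` or the rest of `μ` (so fired and ghost systems extract the SAME `c₀`).
[cite: Balaban1985Averaging, (10) p.19; Balaban1987RG1, (0.4) p.253] -/
theorem map_withDensity_mul_eq_smul_of_invariant {Y : Type*} [MeasurableSpace Y] (μ : Measure (GaugeField P j G)) [IsFiniteMeasure μ]
    (R : Set (PBond P j)) [DecidablePred (· ∈ R)]
    (hμR : ∀ h : GaugeField P j G, (∀ b, b ∉ R → h b = 1) → MeasurePreserving (fun (U : GaugeField P j G) b => U b * h b) μ μ)
    {fc : GaugeField P j G → ℝ≥0∞} (hfc : Measurable fc) (hfcR : ∀ U U' : GaugeField P j G, (∀ b ∈ R, U b = U' b) → fc U = fc U')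
    {f' : GaugeField P j G → ℝ≥0∞} (hf' : Measurable f') (hf'R : ∀ U U' : GaugeField P j G, (∀ b, b ∉ R → U b = U' b) → f' U = f' U')
    {φ : GaugeField P j G → Y} (hφ : Measurable φ) (hφR : ∀ U U' : GaugeField P j G, (∀ b, b ∉ R → U b = U' b) → φ U = φ U') :
    (μ.withDensity (fun U => fc U * f' U)).map φ =
      (∫⁻ u, fc (fun b => if hb : b ∈ R then u ⟨b, hb⟩ else 1) ∂(Measure.pi fun _ : ↥R => (HaarData.haar : Measure G))) • (μ.withDensity f').map φ := by
  classical
  haveI : IsProbabilityMeasure (HaarData.haar : Measure G) := HaarData.isProb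
  have hpA : Measurable (fun (U : GaugeField P j G) (b : ↥R) => U b) := measurable_pi_iff.mpr fun b => measurable_pi_apply (b : PBond P j)
  have hpB : Measurable (fun (U : GaugeField P j G) (b : ↥Rᶜ) => U b) := measurable_pi_iff.mpr fun b => measurable_pi_apply (b : PBond P j)
  have hsplit : Measurable (fun U : GaugeField P j G => ((fun b : ↥Rᶜ => U b), (fun b : ↥R => U b))) := hpB.prodMk hpA
  have hκ := map_split_eq_fst_prod_of_invariant μ R hμR
  -- factor the three functions through the split
  set Fc : (↥R → G) → ℝ≥0∞ := fun u => fc (fun b => if hb : b ∈ R then u ⟨b, hb⟩ else 1) with hFc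
  set F' : (↥Rᶜ → G) → ℝ≥0∞ := fun v => f' (fun b => if hb : b ∈ R then (1 : G) else v ⟨b, hb⟩) with hF'
  set Φ' : (↥Rᶜ → G) → Y := fun v => φ (fun b => if hb : b ∈ R then (1 : G) else v ⟨b, hb⟩) with hΦ'
  have hFcm : Measurable Fc := hfc.comp (measurable_fillR (G := G) R)
  have hF'm : Measurable F' := hf'.comp (measurable_fillRc (G := G) R)
  have hΦ'm : Measurable Φ' := hφ.comp (measurable_fillRc (G := G) R)
  have hfc_eq : ∀ U : GaugeField P j G, fc U = Fc (fun b : ↥R => U b) := fun U => hfcR _ _ fun b hb => by simp [hb]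
  have hf'_eq : ∀ U : GaugeField P j G, f' U = F' (fun b : ↥Rᶜ => U b) := fun U => hf'R _ _ fun b hb => by simp [hb]
  have hφ_eq : ∀ U : GaugeField P j G, φ U = Φ' (fun b : ↥Rᶜ => U b) := fun U => hφR _ _ fun b hb => by simp [hb]
  ext B hB
  rw [Measure.map_apply hφ hB, withDensity_apply _ (hφ hB), Measure.smul_apply, Measure.map_apply hφ hB, withDensity_apply _ (hφ hB), smul_eq_mul,
    ← lintegral_indicator (hφ hB), ← lintegral_indicator (hφ hB)]
  -- both integrands through the split
  have h1 : (fun U => (φ ⁻¹' B).indicator (fun U => fc U * f' U) U) =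
      (fun p : (↥Rᶜ → G) × (↥R → G) => (F' p.1 * (Φ' ⁻¹' B).indicator 1 p.1) * Fc p.2) ∘ fun U : GaugeField P j G => ((fun b : ↥Rᶜ => U b), (fun b : ↥R => U b)) := by
    funext U
    show (φ ⁻¹' B).indicator (fun U => fc U * f' U) U = F' (fun b : ↥Rᶜ => U b) * (Φ' ⁻¹' B).indicator 1 (fun b : ↥Rᶜ => U b) * Fc (fun b : ↥R => U b)
    by_cases hU : U ∈ φ ⁻¹' B
    · have hU' : (fun b : ↥Rᶜ => U b) ∈ Φ' ⁻¹' B := by rw [Set.mem_preimage, ← hφ_eq]; exact hU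
      rw [Set.indicator_of_mem hU, Set.indicator_of_mem hU', Pi.one_apply, mul_one, hfc_eq, hf'_eq, mul_comm]
    · have hU' : (fun b : ↥Rᶜ => U b) ∉ Φ' ⁻¹' B := by rw [Set.mem_preimage, ← hφ_eq]; exact hU
      rw [Set.indicator_of_notMem hU, Set.indicator_of_notMem hU', mul_zero, zero_mul]
  have h2 : (fun U => (φ ⁻¹' B).indicator f' U) =
      (fun p : (↥Rᶜ → G) × (↥R → G) => (F' p.1 * (Φ' ⁻¹' B).indicator 1 p.1) * 1) ∘ fun U : GaugeField P j G => ((fun b : ↥Rᶜ => U b), (fun b : ↥R => U b)) := by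
    funext U
    show (φ ⁻¹' B).indicator f' U = F' (fun b : ↥Rᶜ => U b) * (Φ' ⁻¹' B).indicator 1 (fun b : ↥Rᶜ => U b) * 1
    by_cases hU : U ∈ φ ⁻¹' B
    · have hU' : (fun b : ↥Rᶜ => U b) ∈ Φ' ⁻¹' B := by rw [Set.mem_preimage, ← hφ_eq]; exact hU
      rw [Set.indicator_of_mem hU, Set.indicator_of_mem hU', Pi.one_apply, mul_one, mul_one, hf'_eq]
    · have hU' : (fun b : ↥Rᶜ => U b) ∉ Φ' ⁻¹' B := by rw [Set.mem_preimage, ← hφ_eq]; exact hU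
      rw [Set.indicator_of_notMem hU, Set.indicator_of_notMem hU', mul_zero, zero_mul]
  have hGm : Measurable (fun v : ↥Rᶜ → G => F' v * (Φ' ⁻¹' B).indicator 1 v) := hF'm.mul (measurable_one.indicator (hΦ'm hB))
  have hI1 : Measurable (fun p : (↥Rᶜ → G) × (↥R → G) => (F' p.1 * (Φ' ⁻¹' B).indicator 1 p.1) * Fc p.2) := (hGm.comp measurable_fst).mul (hFcm.comp measurable_snd)
  have hI2 : Measurable (fun p : (↥Rᶜ → G) × (↥R → G) => (F' p.1 * (Φ' ⁻¹' B).indicator 1 p.1) * 1) := (hGm.comp measurable_fst).mul measurable_const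
  rw [h1, h2]
  simp only [Function.comp_def]
  rw [← lintegral_map hI1 hsplit, ← lintegral_map hI2 hsplit, hκ,
    lintegral_prod_mul hGm.aemeasurable hFcm.aemeasurable, lintegral_prod_mul hGm.aemeasurable measurable_const.aemeasurable,
    lintegral_const, measure_univ, mul_one, mul_one, mul_comm]

end Summit.QuantumFields.YangMills.Theorems.BalabanUVNodesN08MarkovReadSetTonelli

end
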